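import Summits.QuantumFields.YangMills.Theorems.UnitScaleTiltFluctuationComparisonRegPrGlobalSlackCanonicalOnPrintChiChiV4
import Summits.QuantumFields.YangMills.Theorems.UnitScaleTiltFluctuationComparisonRegPrGlobalSlackCanonicalOnChiChiCV4
import HarnessLib

/-!
# `UnitScaleTiltFluctuationComparisonRegPrGlobalSlackCanonicalPolymerRowChiV4` — THE v4 TWIN (★★OWNER RULING g26-№14 (F-2b); P22b, width seat ym-ust-20520-w2 g4; skeleton v5kD; record-free decls imported from `…GlobalSlackCanonicalPolymerRowChi`) of `…GlobalSlackCanonicalPolymerRowChi` — BOTH χ-STUBS OF v5kC FROM ONE PER-TERM TWO-RUN ROW AT THE χ-RECORD'S CANONICAL TERM FUNCTION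
# (POLYMER CURRENCY, NO CHART FAMILY), BY NAME (crux `FluctuationComparisonRegPrIntL`, stmt-QuantumFields-20520, skeleton v5kC (OWNER C3), STUBS 3⁗χ `stub_globalTwoRunSlackFamChiV4` /
# (i*)χ `stub_smallBlocksSlackOnChiAllChiV4`; width-lever lane B «(R1) print's χ of [Balaban1985UV3] (47) back», seat ym-ust-19935-r1 g4 — dedup with ym-ust-20520-w2 g0's «polymer-currency socket» note
# 22:59:54Z: typed here, on the by-name side)

THE POINT.  The chart-row sockets (`K1aChartRowsKChiV4`, `K1aChartRowsOnChiKChiV4`, the leg forms) commit the supplier to ONE chart family over both runs; the deepest chart-free currency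
the producer reads is [King1986]'s per-polymer two-cut-off row — ONE inequality per listed term of the CORE canonical term function `canonPTRows (toCore ∘ p)` comparing run `K+1`'s
refined term with run `K`'s modulo a `V`-independent constant, with King's additive slack: `GlobalSlackLocalToGlobal.PolymerCauchyMinAtTSlack` (full window; 3⁗χ) and
`GlobalSlackKernelMatchingOn.PolymerCauchyMinAtWSlackOn S` (ON doubly-`S`-good data; (i*)χ).  Everything below it — the (43) decomposition, the level count (weighted volume, NO
`L ≤ M₁` letter), matching, the size row (44) — is a THEOREM for the core canonical polymerisation (`…CanonicalPolymersCore/CoreRows/CoreSizes`), so: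

* §1 **`K1aPolymerRowChiV4 L 𝔠 a₀ a₁ a`** (per record `C ≥ 0`, `γB`; per family / coupling / inhabited χ-package a coherent `p` and the full-window per-term row at decay `𝔠.κ`, `σ = 7`)
  and **`globalTwoRunSlackFamChiV4_of_k1aPolymerRowChiV4 : … → ⟨3⁗χ TEXT VERBATIM⟩`** (`globalTwoRunSlackTail_of_polymerSlack_volC`; windows from `γ ≤ gammaW L 𝔠 0 0`);
* §2 **`K1aPolymerRowOnChiChiV4 L μ 𝔠 a₀ a₁ a`** (the same row asked, for every `0 < ε₀ ≤ a₀`, only on doubly-χ-good data `PrintChi.ChiGood … ε₀ μ`, rate weight `θ(n)²`) and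
  **`smallBlocksSlackOnChiAllChiV4_of_k1aPolymerRowOnChiChiV4 : … → ⟨(i*)χ TEXT VERBATIM⟩`** (count-form On-producer `globalSupRateWSlackOn_of_polymerWSlackOn_count`, p577706);
* §3 **`K1aPolymerRowOnPrintChiChiV4 L 𝔠 a₀ a₁ a`** (the row on print's own χ-sets `atHeights (printChiSets D b₀ p₀)`) ⟹ the (i*)χ′ hypothesis of ★r1 g3's Print engine;
* §4 the chart rows GIVE the polymer row (`k1aPolymerRowChi_of_chartRowsCChi`, `k1aPolymerRowOnChiChi_of_chartRowsOnChiCChi` — via lane A's `polymerCauchyMinAtTSlack_of_charts` /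
  ★r1 g2's `polymerCauchyMinAtTSlackOn_of_charts`): nothing proved for the chart sockets is lost.
NO letter on the record anywhere.  Hypothesis schemas only; nothing of [Balaban1985UV3]/[King1986] is asserted; no numerics; registry untouched (`--supports stmt-QuantumFields-20520`).

References: C. King, CMP 102 (1986) 649–677 [King1986] (Thm 3.4 (3.9) p.656, (3.12)–(3.13) p.657, Prop. 3.6 p.662); T. Bałaban, CMP 102 (1985) 255–275 [Balaban1985UV3] ((7) p.257,
(24) p.262, (43)–(47) pp.266–267, (57) p.270).
-/

set_option autoImplicit false

noncomputable section

namespace Summit.QuantumFields.YangMills.Theorems.GlobalSlackCanonicalOnChi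

open scoped BigOperators
open MeasureTheory Filter
open Literature.MathematicalPhysics.QuantumFieldTheory.Balaban1983to89
open Literature.MathematicalPhysics.QuantumFieldTheory.Balaban1983to89.T3ContinuumYM3Torus
open Literature.MathematicalPhysics.QuantumFieldTheory.Balaban1983to89.T3UnitScaleTilt
open Literature.MathematicalPhysics.QuantumFieldTheory.Balaban1983to89.T3AlphaInputsAC
open Literature.MathematicalPhysics.QuantumFieldTheory.Balaban1983to89.T3AlphaPolymerSocket
open Literature.MathematicalPhysics.QuantumFieldTheory.Balaban1983to89.T3AlphaInputsACTwoRun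
open Literature.MathematicalPhysics.QuantumFieldTheory.Balaban1983to89.T3AlphaInputsACTwoRunLevel
open Literature.MathematicalPhysics.QuantumFieldTheory.Balaban1983to89.T3Thresholds (θBal_succ_le)
open Literature.MathematicalPhysics.QuantumFieldTheory.Balaban1983to89.B12TreeDecay (kappa₀ K₀ K₀_pos kappa₀_nonneg)
open Literature.MathematicalPhysics.QuantumFieldTheory.Balaban1985CMP102
open Literature.MathematicalPhysics.QuantumFieldTheory.Balaban1985CMP102.Setting
open Summit.QuantumFields.Balaban3D.Carriers
open Summit.QuantumFields.Balaban3D.Proofs.Primitives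
open Summit.QuantumFields.Balaban3D.Proofs.GroupModelLieC (lieC)
open Summit.QuantumFields.YangMills.Theorems
open Summit.QuantumFields.YangMills.Theorems.GlobalSlack (GlobalSupRateTSlack)
open Summit.QuantumFields.YangMills.Theorems.GlobalSlackKernelMatching
open Summit.QuantumFields.YangMills.Theorems.GlobalSlackKernelMatchingOn
open Summit.QuantumFields.YangMills.Theorems.GlobalSlackLocalToGlobalOn
open Summit.QuantumFields.YangMills.Theorems.GlobalSlackLocalToGlobalCount (globalTwoRunSlackTail_of_polymerSlack_volC locCount_of_cover_of_volumeC)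
open Summit.QuantumFields.YangMills.Theorems.GlobalSlackCanonicalPolymers
open Summit.QuantumFields.YangMills.Theorems.LogComparisonRepAtHeightsOn (atHeights printChiSets)

/-! ## §1 3⁗χ from one per-term two-run row (full window) -/

/-- **THE PER-TERM TWO-RUN ROW AT THE χ-RECORD'S CANONICAL TERM FUNCTION** (hypothesis schema, never asserted): per record a constant `C ≥ 0` and a threshold, and for every family /
coupling / inhabited χ-package a coherent `p : ∀ K, PkgAtV3Chi …` with [King1986]'s per-polymer two-cut-off row with additive slack for `canonPTRows (toCore ∘ p)` at the datum
`dataOfV4chi p (canonPolymerRows (toCore ∘ p))`, decay `𝔠.κ`, `σ = 7`: for every listed term, `|PT′(Y′)(V) − PT(Y)(V) − c_Y| ≤ C·e^{−𝔠.κ𝓛(Y)}·x⁴·((L^{−(1+j)})^a + θ(n)⁷)`.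
[cite: King1986, Thm 3.4 (3.9) p.656, Prop. 3.6 p.662; Balaban1985UV3, (43)-(44) pp.266-267, (47) p.267] -/
def K1aPolymerRowChiV4 (L : ℕ) (𝔠 : AlphaConsts L (suGroupModel 2).N) (a₀ a₁ a : ℝ) : Prop :=
  ∃ (C γB : ℝ), 0 ≤ C ∧ 0 < γB ∧
    ∀ (F : T3Family) (γ : ℝ) (hF : F.L = L) (hγ : 0 < γ), γ ≤ γB → ∀ (hγ1 : γ ≤ (min (hF ▸ 𝔠).gamma0 1) ^ 2),
      AlphaInputsT3AC.OfV4ChiAt F (hF ▸ 𝔠) a₀ a₁ →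
        ∃ (p : ∀ K, AlphaInputsT3AC.PkgAtV4Chi F (hF ▸ 𝔠) γ hγ hγ1 K), (∀ K, (p K).a₀ = a₀ ∧ (p K).a₁ = a₁) ∧
          GlobalSlackLocalToGlobal.PolymerCauchyMinAtTSlack (AlphaInputsT3AC.dataOfV4chi p (canonPolymerRows fun K => (p K).toRows))
            (canonPTRows fun K => (p K).toRows) (hF ▸ 𝔠).b₀ (hF ▸ 𝔠).p₀ (hF ▸ 𝔠).κ a 7 C

/-- **THE REGISTERED STUB 3⁗χ FROM THE PER-TERM ROW, BY NAME**: threshold `γB ⊓ gammaW L 𝔠 0 0 ⊓ e^{2(1−p₀)}` (the two size-row windows), `π := canonPolymerRows (toCore ∘ p)`; the producer is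
`globalTwoRunSlackTail_of_polymerSlack_volC` over the five core producer theorems (weighted volume `volWeight L M₁`, NO letter on `M₁`). [cite: King1986, Thm 3.4 (3.9) p.656, (3.12)-(3.13) p.657; Balaban1985UV3, (7) p.257, (24) p.262, (43)-(47) pp.266-267] -/
theorem globalTwoRunSlackFamChiV4_of_k1aPolymerRowChiV4
    (h : ∀ (L : ℕ), Odd L → 7 ≤ L → ∀ (𝔠 : AlphaConsts L (suGroupModel 2).N) (a₀ a₁ : ℝ), 0 < a₀ → 0 < a₁ → 𝔠.B₃ * a₁ ≤ a₀ →
      ∃ a : ℝ, 0 < a ∧ a < 1 ∧ K1aPolymerRowChiV4 L 𝔠 a₀ a₁ a) :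
    ∀ (L : ℕ), Odd L → 7 ≤ L → ∀ (𝔠 : Summit.QuantumFields.Balaban3D.Proofs.Primitives.AlphaConsts L (Summit.QuantumFields.Balaban3D.Carriers.suGroupModel 2).N)
      (a₀ a₁ : ℝ), 0 < a₀ → 0 < a₁ → 𝔠.B₃ * a₁ ≤ a₀ →
      ∃ a : ℝ, 0 < a ∧ ∃ γB : ℝ, 0 < γB ∧ ∀ (F : T3Family) (γ : ℝ) (hF : F.L = L) (hγ : 0 < γ), γ ≤ γB →
        ∀ (hγ1 : γ ≤ (min (hF ▸ 𝔠).gamma0 1) ^ 2),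
          Summit.QuantumFields.YangMills.Theorems.AlphaInputsT3AC.OfV4ChiAt F (hF ▸ 𝔠) a₀ a₁ →
          ∃ (p : ∀ K, Summit.QuantumFields.YangMills.Theorems.AlphaInputsT3AC.PkgAtV4Chi F (hF ▸ 𝔠) γ hγ hγ1 K),
            (∀ K, (p K).a₀ = a₀ ∧ (p K).a₁ = a₁) ∧
            ∃ (π : Summit.QuantumFields.YangMills.Theorems.AlphaInputsT3AC.PolymerT3 F) (σ : ℕ) (C : ℝ), 7 ≤ σ ∧ 0 ≤ C ∧
              Summit.QuantumFields.YangMills.Theorems.GlobalSlack.GlobalSupRateTSlack (Summit.QuantumFields.YangMills.Theorems.AlphaInputsT3AC.dataOfV4chi p π) (hF ▸ 𝔠).b₀ (hF ▸ 𝔠).p₀ a σ C := by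
  intro L hLo h7 𝔠 a₀ a₁ ha0 ha1 hw
  obtain ⟨a, ha, ha1', C, γB, hC, hγB, hall⟩ := h L hLo h7 𝔠 a₀ a₁ ha0 ha1 hw
  obtain ⟨hκ0, hκ₀⟩ := kappa_record_admissible 𝔠
  refine ⟨a, ha, min γB (min (gammaW L 𝔠 0 0) (Real.exp (2 * (1 - 𝔠.p₀)))),
    lt_min hγB (lt_min (gammaW_pos L 𝔠 0 0) (Real.exp_pos _)), fun F γ hF hγ hγle hγ1 hOf => ?_⟩
  subst hF
  have hγB' : γ ≤ γB := hγle.trans (min_le_left _ _)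
  have hW : γ ≤ gammaW F.L 𝔠 0 0 := hγle.trans ((min_le_right _ _).trans (min_le_left _ _))
  have hγe : Real.sqrt γ ≤ Real.exp (1 - 𝔠.p₀) := sqrt_le_exp_of_le (hγle.trans ((min_le_right _ _).trans (min_le_right _ _)))
  have h1 : γ ≤ gammaθ 𝔠.b₀ (𝔠.p₀ + 𝔠.r₀) (𝔠.ρ / (4 * max 1 𝔠.cB)) := hW.trans ((min_le_right _ _).trans (min_le_left _ _))
  have h2 : γ ≤ gammaθ 𝔠.b₀ 𝔠.p₀ (1 / (2 * (8 * ((F.L : ℝ) + 1) ^ 2 * 𝔠.B₃ * 𝔠.Zfull))) := hW.trans ((min_le_right _ _).trans (min_le_right _ _))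
  have hγ1' : γ ≤ 1 := hγ1.trans (sq_min_one_le _ 𝔠.gamma0_pos)
  obtain ⟨p, hp, hPC⟩ := hall F γ rfl hγ hγB' hγ1 hOf
  set q : ∀ K, AlphaInputsT3AC.PkgCoreRows F 𝔠 γ hγ hγ1 K := fun K => (p K).toRows
  have hw1 := fun K k hk => window_jet (hγ := hγ) (hγ1 := hγ1) h1 K k hk
  have hw2 := fun K k hk => window_oldSlice (hγ := hγ) (hγ1 := hγ1) h2 K k hk
  have hCT : 0 ≤ max (newConst 𝔠) (oldConst 𝔠 * (F.L : ℝ) ^ 4 * Real.exp (𝔠.κ * (F.L : ℝ) ^ 3)) := le_max_of_le_left (newConst_nonneg 𝔠)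
  obtain ⟨σ, C₀, hσ, hC₀, hG⟩ := globalTwoRunSlackTail_of_polymerSlack_volC (D := AlphaInputsT3AC.dataOfCoreRows q (canonPolymerRows q))
    hγ hγ1' hγe 𝔠.b₀_pos 𝔠.p₀_pos.le ha ha1' hC hCT le_rfl
    (pintDecompTrivT_canonRows q) (locCover_canonRows q hκ0.le hκ₀) (locBlockVolumeC_canonRows q) (locMatched_canonRows q)
    (termSizeTrivT_canonRows q hκ0 le_rfl hw1 hw2) hPC
  exact ⟨p, hp, canonPolymerRows q, σ, C₀, hσ, hC₀, hG⟩

/-! ## §2 (i*)χ from one per-term two-run row on χ-good data -/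

/-- **THE PER-TERM TWO-RUN ROW ON χ-GOOD DATA AT THE χ-RECORD'S CANONICAL TERM FUNCTION** (hypothesis schema, never asserted): as `K1aPolymerRowChiV4` but, for every regularity threshold
`0 < ε₀ ≤ a₀`, the row is asked only at window data that are χ-good with margin `μ` for BOTH runs (`PrintChi.ChiGood F γ b₀ p₀ ε₀ μ`), rate weight `θ(n)²`, `σ = 7` — the small-block
currency of the (R1) line with NO chart family. [cite: King1986, Thm 3.4 (3.9) p.656, Prop. 3.6 p.662; Balaban1985UV3, (43)-(44) pp.266-267, (47) p.267] -/
def K1aPolymerRowOnChiChiV4 (L : ℕ) (μ : ℝ) (𝔠 : AlphaConsts L (suGroupModel 2).N) (a₀ a₁ a : ℝ) : Prop :=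
  ∃ (C γB : ℝ), 0 ≤ C ∧ 0 < γB ∧
    ∀ (F : T3Family) (γ : ℝ) (hF : F.L = L) (hγ : 0 < γ), γ ≤ γB → ∀ (hγ1 : γ ≤ (min (hF ▸ 𝔠).gamma0 1) ^ 2),
      AlphaInputsT3AC.OfV4ChiAt F (hF ▸ 𝔠) a₀ a₁ →
        ∃ (p : ∀ K, AlphaInputsT3AC.PkgAtV4Chi F (hF ▸ 𝔠) γ hγ hγ1 K), (∀ K, (p K).a₀ = a₀ ∧ (p K).a₁ = a₁) ∧
          ∀ ε₀ : ℝ, 0 < ε₀ → ε₀ ≤ a₀ →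
            PolymerCauchyMinAtWSlackOn (fun K n h V => PrintChi.ChiGood F γ (hF ▸ 𝔠).b₀ (hF ▸ 𝔠).p₀ ε₀ μ (n := n) (K := K) h V)
              (AlphaInputsT3AC.dataOfV4chi p (canonPolymerRows fun K => (p K).toRows)) (canonPTRows fun K => (p K).toRows)
              (hF ▸ 𝔠).b₀ (hF ▸ 𝔠).p₀ (hF ▸ 𝔠).κ (fun n => θBal F.L γ (hF ▸ 𝔠).b₀ (hF ▸ 𝔠).p₀ n ^ 2) a 7 C

/-- **ONE BLOCK SIZE, ONE MARGIN**: the per-term row on χ at `(L, μ)` for every record ⟹ the (i*)χ-clause at `(L, μ)` — threshold `γB ⊓ gammaW L 𝔠 0 0 ⊓ e^{2(1−p₀)}`,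
`π := canonPolymerRows (toCore ∘ p)`, `σ := 7`, constant `(max(C′,0)/volWeight L M₁)·(C_T + C/(1 − L^{a−1}) + C/(1 − L⁻¹))` uniform in `ε₀`; producer
`globalSupRateWSlackOn_of_polymerWSlackOn_count`. [cite: King1986, Thm 3.4 (3.9) p.656, (3.12)-(3.13) p.657; Balaban1985UV3, (7) p.257, (24) p.262, (43)-(47) pp.266-267] -/
theorem slackOnChiAtChiV4_of_k1aPolymerRowOnChiChiV4 (L : ℕ) (μ : ℝ)
    (h : ∀ (𝔠 : AlphaConsts L (suGroupModel 2).N) (a₀ a₁ : ℝ),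
      0 < a₀ → 0 < a₁ → 𝔠.B₃ * a₁ ≤ a₀ → ∃ a : ℝ, 0 < a ∧ a < 1 ∧ K1aPolymerRowOnChiChiV4 L μ 𝔠 a₀ a₁ a) :
    ∀ (𝔠 : Summit.QuantumFields.Balaban3D.Proofs.Primitives.AlphaConsts L (Summit.QuantumFields.Balaban3D.Carriers.suGroupModel 2).N)
      (a₀ a₁ : ℝ), 0 < a₀ → 0 < a₁ → 𝔠.B₃ * a₁ ≤ a₀ →
      ∃ a : ℝ, 0 < a ∧ ∃ γB : ℝ, 0 < γB ∧ ∀ (F : T3Family) (γ : ℝ) (hF : F.L = L) (hγ : 0 < γ), γ ≤ γB →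
        ∀ (hγ1 : γ ≤ (min (hF ▸ 𝔠).gamma0 1) ^ 2),
          Summit.QuantumFields.YangMills.Theorems.AlphaInputsT3AC.OfV4ChiAt F (hF ▸ 𝔠) a₀ a₁ →
          ∃ (p : ∀ K, Summit.QuantumFields.YangMills.Theorems.AlphaInputsT3AC.PkgAtV4Chi F (hF ▸ 𝔠) γ hγ hγ1 K),
            (∀ K, (p K).a₀ = a₀ ∧ (p K).a₁ = a₁) ∧
            ∃ (π : Summit.QuantumFields.YangMills.Theorems.AlphaInputsT3AC.PolymerT3 F) (σ : ℕ) (C : ℝ), 7 ≤ σ ∧ 0 ≤ C ∧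
              ∀ ε₀ : ℝ, 0 < ε₀ → ε₀ ≤ a₀ →
                Summit.QuantumFields.YangMills.Theorems.PrintChi.GlobalSupRateTSlackOn
                  (fun K n h V => Summit.QuantumFields.YangMills.Theorems.PrintChi.ChiGood F γ (hF ▸ 𝔠).b₀ (hF ▸ 𝔠).p₀ ε₀ μ (n := n) (K := K) h V)
                  (Summit.QuantumFields.YangMills.Theorems.AlphaInputsT3AC.dataOfV4chi p π) (hF ▸ 𝔠).b₀ (hF ▸ 𝔠).p₀ a σ C := by
  intro 𝔠 a₀ a₁ ha0 ha1 hw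
  obtain ⟨a, ha, ha1', C, γB, hC, hγB, hall⟩ := h 𝔠 a₀ a₁ ha0 ha1 hw
  obtain ⟨hκ0, hκ₀⟩ := kappa_record_admissible 𝔠
  refine ⟨a, ha, min γB (min (gammaW L 𝔠 0 0) (Real.exp (2 * (1 - 𝔠.p₀)))),
    lt_min hγB (lt_min (gammaW_pos L 𝔠 0 0) (Real.exp_pos _)), fun F γ hF hγ hγle hγ1 hOf => ?_⟩
  subst hF
  have hLn : 1 ≤ F.L := F.hL.2.le
  have hγB' : γ ≤ γB := hγle.trans (min_le_left _ _)
  have hW : γ ≤ gammaW F.L 𝔠 0 0 := hγle.trans ((min_le_right _ _).trans (min_le_left _ _))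
  have hγe : Real.sqrt γ ≤ Real.exp (1 - 𝔠.p₀) := sqrt_le_exp_of_le (hγle.trans ((min_le_right _ _).trans (min_le_right _ _)))
  have h1 : γ ≤ gammaθ 𝔠.b₀ (𝔠.p₀ + 𝔠.r₀) (𝔠.ρ / (4 * max 1 𝔠.cB)) := hW.trans ((min_le_right _ _).trans (min_le_left _ _))
  have h2 : γ ≤ gammaθ 𝔠.b₀ 𝔠.p₀ (1 / (2 * (8 * ((F.L : ℝ) + 1) ^ 2 * 𝔠.B₃ * 𝔠.Zfull))) := hW.trans ((min_le_right _ _).trans (min_le_right _ _))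
  have hγ1' : γ ≤ 1 := hγ1.trans (sq_min_one_le _ 𝔠.gamma0_pos)
  have hθ0 : ∀ n, 0 ≤ θBal F.L γ 𝔠.b₀ 𝔠.p₀ n := fun n => (T3MinimiserStabilityReduction.θBal_pos hLn hγ hγ1' 𝔠.b₀_pos 𝔠.p₀ n).le
  obtain ⟨p, hp, hrows⟩ := hall F γ rfl hγ hγB' hγ1 hOf
  set q : ∀ K, AlphaInputsT3AC.PkgCoreRows F 𝔠 γ hγ hγ1 K := fun K => (p K).toRows
  have hw1 := fun K k hk => window_jet (hγ := hγ) (hγ1 := hγ1) h1 K k hk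
  have hw2 := fun K k hk => window_oldSlice (hγ := hγ) (hγ1 := hγ1) h2 K k hk
  have hCT : 0 ≤ max (newConst 𝔠) (oldConst 𝔠 * (F.L : ℝ) ^ 4 * Real.exp (𝔠.κ * (F.L : ℝ) ^ 3)) := le_max_of_le_left (newConst_nonneg 𝔠)
  refine ⟨p, hp, canonPolymerRows q, 7, _, le_rfl,
    producerConstC_nonneg F (C' := max 1 (K₀ (4 * 2 ^ 3) (2 * 3))) ha1' hC hCT (volWeight_canon_pos 𝔠), fun ε₀ hε hεa => ?_⟩
  exact (printChi_globalSupRateTSlackOn_iff_W _ _ _ _ _ _ _).2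
    (globalSupRateWSlackOn_of_polymerWSlackOn_count _ (w := fun n => θBal F.L γ 𝔠.b₀ 𝔠.p₀ n ^ 2) hγ hγ1' 𝔠.b₀_pos (fun n => pow_nonneg (hθ0 n) 2)
      (fun n => pow_le_pow_left₀ (hθ0 (n + 1)) (θBal_succ_le hLn hγ hγ1' hγe 𝔠.b₀_pos.le 𝔠.p₀_pos.le n) 2) ha ha1' hC hCT
      (pintDecompTrivT_canonRows q) (locCount_of_cover_of_volumeC (locCover_canonRows q hκ0.le hκ₀) (locBlockVolumeC_canonRows q))
      (locMatched_canonRows q) (termSizeTrivT_canonRows q hκ0 le_rfl hw1 hw2) (hrows ε₀ hε hεa))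

/-- **THE REGISTERED STUB (i*)χ FROM THE PER-TERM ROW ON χ, BY NAME.** [cite: King1986, Thm 3.4 (3.9) p.656, Prop. 3.6 p.662; Balaban1985UV3, (47) p.267] -/
theorem smallBlocksSlackOnChiAllChiV4_of_k1aPolymerRowOnChiChiV4
    (h : ∀ (L : ℕ), Odd L → 1 < L → L < 7 → ∀ (μ : ℝ), 0 < μ → μ < 1 → ∀ (𝔠 : AlphaConsts L (suGroupModel 2).N) (a₀ a₁ : ℝ),
      0 < a₀ → 0 < a₁ → 𝔠.B₃ * a₁ ≤ a₀ → ∃ a : ℝ, 0 < a ∧ a < 1 ∧ K1aPolymerRowOnChiChiV4 L μ 𝔠 a₀ a₁ a) :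
    ∀ (L : ℕ), Odd L → 1 < L → L < 7 → ∀ (μ : ℝ), 0 < μ → μ < 1 →
      ∀ (𝔠 : Summit.QuantumFields.Balaban3D.Proofs.Primitives.AlphaConsts L (Summit.QuantumFields.Balaban3D.Carriers.suGroupModel 2).N)
        (a₀ a₁ : ℝ), 0 < a₀ → 0 < a₁ → 𝔠.B₃ * a₁ ≤ a₀ →
        ∃ a : ℝ, 0 < a ∧ ∃ γB : ℝ, 0 < γB ∧ ∀ (F : T3Family) (γ : ℝ) (hF : F.L = L) (hγ : 0 < γ), γ ≤ γB →
          ∀ (hγ1 : γ ≤ (min (hF ▸ 𝔠).gamma0 1) ^ 2),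
            Summit.QuantumFields.YangMills.Theorems.AlphaInputsT3AC.OfV4ChiAt F (hF ▸ 𝔠) a₀ a₁ →
            ∃ (p : ∀ K, Summit.QuantumFields.YangMills.Theorems.AlphaInputsT3AC.PkgAtV4Chi F (hF ▸ 𝔠) γ hγ hγ1 K),
              (∀ K, (p K).a₀ = a₀ ∧ (p K).a₁ = a₁) ∧
              ∃ (π : Summit.QuantumFields.YangMills.Theorems.AlphaInputsT3AC.PolymerT3 F) (σ : ℕ) (C : ℝ), 7 ≤ σ ∧ 0 ≤ C ∧
                ∀ ε₀ : ℝ, 0 < ε₀ → ε₀ ≤ a₀ →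
                  Summit.QuantumFields.YangMills.Theorems.PrintChi.GlobalSupRateTSlackOn
                    (fun K n h V => Summit.QuantumFields.YangMills.Theorems.PrintChi.ChiGood F γ (hF ▸ 𝔠).b₀ (hF ▸ 𝔠).p₀ ε₀ μ (n := n) (K := K) h V)
                    (Summit.QuantumFields.YangMills.Theorems.AlphaInputsT3AC.dataOfV4chi p π) (hF ▸ 𝔠).b₀ (hF ▸ 𝔠).p₀ a σ C :=
  fun L hLo hL1 hL7 μ hμ0 hμ1 => slackOnChiAtChiV4_of_k1aPolymerRowOnChiChiV4 L μ (h L hLo hL1 hL7 μ hμ0 hμ1)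

/-! ## §3 The chart rows give the polymer rows (nothing proved for the chart sockets is lost) -/

/-- `K1aChartRowsCChiV4 → K1aPolymerRowChiV4` (lane A's `polymerCauchyMinAtTSlack_of_charts`, then decay monotonicity is not needed: the chart rows at `κ ≤ 𝔠.κ`… — we use the
`K`-shape `K1aChartRowsKChiV4` (decay `𝔠.κ`); window `(C_s + C_B)θ ≤ 1` from `γ ≤ gammaW L 𝔠 C_s C_B`). [cite: King1986, Prop. 3.6 p.662; Balaban1985UV3, (43)-(46) pp.266-267, (57) p.270] -/
theorem k1aPolymerRowChiV4_of_chartRowsKChiV4 {L : ℕ} {𝔠 : AlphaConsts L (suGroupModel 2).N} {a₀ a₁ a : ℝ} (h : K1aChartRowsKChiV4 L 𝔠 a₀ a₁ a) :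
    K1aPolymerRowChiV4 L 𝔠 a₀ a₁ a := by
  obtain ⟨C, C_E, C_R, C_s, C_B, γB, hC, hCE, hCR, hCs, hCB, hγB, hall⟩ := h
  refine ⟨5 * (C_s ^ 2 * C + 6 * C_s * C_B * C_E) + 2 * C_R, min γB (gammaW L 𝔠 C_s C_B), by positivity, lt_min hγB (gammaW_pos L 𝔠 C_s C_B),
    fun F γ hF hγ hγle hγ1 hOf => ?_⟩
  subst hF
  have hγB' : γ ≤ γB := hγle.trans (min_le_left _ _)
  have hW : γ ≤ gammaW F.L 𝔠 C_s C_B := hγle.trans (min_le_right _ _)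
  have h0 : γ ≤ gammaθ 𝔠.b₀ 𝔠.p₀ (1 / max 1 (C_s + C_B)) := hW.trans (min_le_left _ _)
  have hγ1' : γ ≤ 1 := hγ1.trans (sq_min_one_le _ 𝔠.gamma0_pos)
  have hL1 : (1 : ℝ) ≤ (F.L : ℝ) := by exact_mod_cast F.hL.2.le
  have hθ0 : ∀ n, 0 ≤ θBal F.L γ 𝔠.b₀ 𝔠.p₀ n := fun n => (T3MinimiserStabilityReduction.θBal_pos F.hL.2.le hγ hγ1' 𝔠.b₀_pos 𝔠.p₀ n).le
  have hwin : ∀ n, (C_s + C_B) * θBal F.L γ 𝔠.b₀ 𝔠.p₀ n ≤ 1 := fun n => window_sum_le_one F.hL.2.le 𝔠.b₀_pos 𝔠.p₀_pos hγ hγ1' h0 n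
  obtain ⟨p, hp, Φ, e, B, R, hT, hK, hE, hR, hS, hBC⟩ := hall F γ rfl hγ hγB' hγ1 hOf
  exact ⟨p, hp, (polymerCauchyMinAtTSlack_iff_localToGlobal _ _ _ _ _ _ _ _).1
    (polymerCauchyMinAtTSlack_of_charts hC hCE hCR hCs hCB hL1 hθ0 hwin hT hK hE hR hS hBC)⟩

/-- `K1aChartRowsOnChiKChiV4 → K1aPolymerRowOnChiChiV4` (★r1 g2's `polymerCauchyMinAtTSlackOn_of_charts` for each `ε₀`). [cite: King1986, Prop. 3.6 p.662; Balaban1985UV3, (43)-(47) pp.266-267, (57) p.270] -/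
theorem k1aPolymerRowOnChiChiV4_of_chartRowsOnChiKChiV4 {L : ℕ} {μ : ℝ} {𝔠 : AlphaConsts L (suGroupModel 2).N} {a₀ a₁ a : ℝ} (h : K1aChartRowsOnChiKChiV4 L μ 𝔠 a₀ a₁ a) :
    K1aPolymerRowOnChiChiV4 L μ 𝔠 a₀ a₁ a := by
  obtain ⟨C, C_E, C_R, C_s, C_B, γB, hC, hCE, hCR, hCs, hCB, hγB, hall⟩ := h
  refine ⟨5 * (C_s ^ 2 * C + 6 * C_s * C_B * C_E) + 2 * C_R, min γB (gammaW L 𝔠 C_s C_B), by positivity, lt_min hγB (gammaW_pos L 𝔠 C_s C_B),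
    fun F γ hF hγ hγle hγ1 hOf => ?_⟩
  subst hF
  have hγB' : γ ≤ γB := hγle.trans (min_le_left _ _)
  have hW : γ ≤ gammaW F.L 𝔠 C_s C_B := hγle.trans (min_le_right _ _)
  have h0 : γ ≤ gammaθ 𝔠.b₀ 𝔠.p₀ (1 / max 1 (C_s + C_B)) := hW.trans (min_le_left _ _)
  have hγ1' : γ ≤ 1 := hγ1.trans (sq_min_one_le _ 𝔠.gamma0_pos)
  have hL1 : (1 : ℝ) ≤ (F.L : ℝ) := by exact_mod_cast F.hL.2.le
  have hθ0 : ∀ n, 0 ≤ θBal F.L γ 𝔠.b₀ 𝔠.p₀ n := fun n => (T3MinimiserStabilityReduction.θBal_pos F.hL.2.le hγ hγ1' 𝔠.b₀_pos 𝔠.p₀ n).le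
  have hwin : ∀ n, (C_s + C_B) * θBal F.L γ 𝔠.b₀ 𝔠.p₀ n ≤ 1 := fun n => window_sum_le_one F.hL.2.le 𝔠.b₀_pos 𝔠.p₀_pos hγ hγ1' h0 n
  obtain ⟨p, hp, hrows⟩ := hall F γ rfl hγ hγB' hγ1 hOf
  refine ⟨p, hp, fun ε₀ hε hεa => ?_⟩
  obtain ⟨Φ, e, B, R, hT, hK, hE, hR, hS, hBC⟩ := hrows ε₀ hε hεa
  exact polymerCauchyMinAtTSlackOn_of_charts _ hC hCE hCR hCs hCB hL1 hθ0 hwin hT hK hE hR hS hBC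

/-! ## §4 (i*)χ′: the per-term row on print's own χ-sets -/

/-- **THE PER-TERM TWO-RUN ROW ON PRINT'S χ-SETS OF THE DATUM** (hypothesis schema, never asserted): as `K1aPolymerRowOnChiChiV4` with the window sub-predicate
`atHeights (printChiSets D 𝔠.b₀ 𝔠.p₀)` of the χ-datum `D := dataOfV4chi p (canonPolymerRows (toCore ∘ p))` — no margin `μ`, no `ε₀`-family (★r1 g3's (i*)χ′ option in polymer currency).
[cite: King1986, Thm 3.4 (3.9) p.656, Prop. 3.6 p.662; Balaban1985UV3, (43)-(44) pp.266-267, (47) p.267] -/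
def K1aPolymerRowOnPrintChiChiV4 (L : ℕ) (𝔠 : AlphaConsts L (suGroupModel 2).N) (a₀ a₁ a : ℝ) : Prop :=
  ∃ (C γB : ℝ), 0 ≤ C ∧ 0 < γB ∧
    ∀ (F : T3Family) (γ : ℝ) (hF : F.L = L) (hγ : 0 < γ), γ ≤ γB → ∀ (hγ1 : γ ≤ (min (hF ▸ 𝔠).gamma0 1) ^ 2),
      AlphaInputsT3AC.OfV4ChiAt F (hF ▸ 𝔠) a₀ a₁ →
        ∃ (p : ∀ K, AlphaInputsT3AC.PkgAtV4Chi F (hF ▸ 𝔠) γ hγ hγ1 K), (∀ K, (p K).a₀ = a₀ ∧ (p K).a₁ = a₁) ∧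
          PolymerCauchyMinAtWSlackOn
            (atHeights (printChiSets (AlphaInputsT3AC.dataOfV4chi p (canonPolymerRows fun K => (p K).toRows)) (hF ▸ 𝔠).b₀ (hF ▸ 𝔠).p₀))
            (AlphaInputsT3AC.dataOfV4chi p (canonPolymerRows fun K => (p K).toRows)) (canonPTRows fun K => (p K).toRows)
            (hF ▸ 𝔠).b₀ (hF ▸ 𝔠).p₀ (hF ▸ 𝔠).κ (fun n => θBal F.L γ (hF ▸ 𝔠).b₀ (hF ▸ 𝔠).p₀ n ^ 2) a 7 C

/-- **THE (i*)χ′ HYPOTHESIS OF ★r1 g3's PRINT ENGINE FROM THE PER-TERM ROW ON PRINT'S χ-SETS, BY NAME** (count-form On-producer at `S := atHeights (printChiSets D b₀ p₀)`; threshold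
`γB ⊓ gammaW L 𝔠 0 0 ⊓ e^{2(1−p₀)}`, `π := canonPolymerRows (toCore ∘ p)`, `σ := 7`). [cite: King1986, Thm 3.4 (3.9) p.656, (3.12)-(3.13) p.657; Balaban1985UV3, (7) p.257, (24) p.262, (43)-(47) pp.266-267] -/
theorem smallBlocksSlackOnPrintChiV4_of_k1aPolymerRowOnPrintChiChiV4
    (h : ∀ (L : ℕ), Odd L → 1 < L → L < 7 → ∀ (𝔠 : AlphaConsts L (suGroupModel 2).N) (a₀ a₁ : ℝ),
      0 < a₀ → 0 < a₁ → 𝔠.B₃ * a₁ ≤ a₀ → ∃ a : ℝ, 0 < a ∧ a < 1 ∧ K1aPolymerRowOnPrintChiChiV4 L 𝔠 a₀ a₁ a) :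
    ∀ (L : ℕ), Odd L → 1 < L → L < 7 →
      ∀ (𝔠 : Summit.QuantumFields.Balaban3D.Proofs.Primitives.AlphaConsts L (Summit.QuantumFields.Balaban3D.Carriers.suGroupModel 2).N)
        (a₀ a₁ : ℝ), 0 < a₀ → 0 < a₁ → 𝔠.B₃ * a₁ ≤ a₀ →
        ∃ a : ℝ, 0 < a ∧ ∃ γB : ℝ, 0 < γB ∧ ∀ (F : T3Family) (γ : ℝ) (hF : F.L = L) (hγ : 0 < γ), γ ≤ γB →
          ∀ (hγ1 : γ ≤ (min (hF ▸ 𝔠).gamma0 1) ^ 2),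
            Summit.QuantumFields.YangMills.Theorems.AlphaInputsT3AC.OfV4ChiAt F (hF ▸ 𝔠) a₀ a₁ →
            ∃ (p : ∀ K, Summit.QuantumFields.YangMills.Theorems.AlphaInputsT3AC.PkgAtV4Chi F (hF ▸ 𝔠) γ hγ hγ1 K),
              (∀ K, (p K).a₀ = a₀ ∧ (p K).a₁ = a₁) ∧
              ∃ (π : Summit.QuantumFields.YangMills.Theorems.AlphaInputsT3AC.PolymerT3 F) (σ : ℕ) (C : ℝ), 7 ≤ σ ∧ 0 ≤ C ∧
                Summit.QuantumFields.YangMills.Theorems.PrintChi.GlobalSupRateTSlackOn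
                  (atHeights (printChiSets (Summit.QuantumFields.YangMills.Theorems.AlphaInputsT3AC.dataOfV4chi p π) (hF ▸ 𝔠).b₀ (hF ▸ 𝔠).p₀))
                  (Summit.QuantumFields.YangMills.Theorems.AlphaInputsT3AC.dataOfV4chi p π) (hF ▸ 𝔠).b₀ (hF ▸ 𝔠).p₀ a σ C := by
  intro L hLo hL1 hL7 𝔠 a₀ a₁ ha0 ha1 hw
  obtain ⟨a, ha, ha1', C, γB, hC, hγB, hall⟩ := h L hLo hL1 hL7 𝔠 a₀ a₁ ha0 ha1 hw
  obtain ⟨hκ0, hκ₀⟩ := kappa_record_admissible 𝔠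
  refine ⟨a, ha, min γB (min (gammaW L 𝔠 0 0) (Real.exp (2 * (1 - 𝔠.p₀)))),
    lt_min hγB (lt_min (gammaW_pos L 𝔠 0 0) (Real.exp_pos _)), fun F γ hF hγ hγle hγ1 hOf => ?_⟩
  subst hF
  have hLn : 1 ≤ F.L := F.hL.2.le
  have hγB' : γ ≤ γB := hγle.trans (min_le_left _ _)
  have hW : γ ≤ gammaW F.L 𝔠 0 0 := hγle.trans ((min_le_right _ _).trans (min_le_left _ _))
  have hγe : Real.sqrt γ ≤ Real.exp (1 - 𝔠.p₀) := sqrt_le_exp_of_le (hγle.trans ((min_le_right _ _).trans (min_le_right _ _)))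
  have h1 : γ ≤ gammaθ 𝔠.b₀ (𝔠.p₀ + 𝔠.r₀) (𝔠.ρ / (4 * max 1 𝔠.cB)) := hW.trans ((min_le_right _ _).trans (min_le_left _ _))
  have h2 : γ ≤ gammaθ 𝔠.b₀ 𝔠.p₀ (1 / (2 * (8 * ((F.L : ℝ) + 1) ^ 2 * 𝔠.B₃ * 𝔠.Zfull))) := hW.trans ((min_le_right _ _).trans (min_le_right _ _))
  have hγ1' : γ ≤ 1 := hγ1.trans (sq_min_one_le _ 𝔠.gamma0_pos)
  have hθ0 : ∀ n, 0 ≤ θBal F.L γ 𝔠.b₀ 𝔠.p₀ n := fun n => (T3MinimiserStabilityReduction.θBal_pos hLn hγ hγ1' 𝔠.b₀_pos 𝔠.p₀ n).le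
  obtain ⟨p, hp, hrow⟩ := hall F γ rfl hγ hγB' hγ1 hOf
  set q : ∀ K, AlphaInputsT3AC.PkgCoreRows F 𝔠 γ hγ hγ1 K := fun K => (p K).toRows
  have hw1 := fun K k hk => window_jet (hγ := hγ) (hγ1 := hγ1) h1 K k hk
  have hw2 := fun K k hk => window_oldSlice (hγ := hγ) (hγ1 := hγ1) h2 K k hk
  have hCT : 0 ≤ max (newConst 𝔠) (oldConst 𝔠 * (F.L : ℝ) ^ 4 * Real.exp (𝔠.κ * (F.L : ℝ) ^ 3)) := le_max_of_le_left (newConst_nonneg 𝔠)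
  have hG := globalSupRateWSlackOn_of_polymerWSlackOn_count
    (atHeights (printChiSets (AlphaInputsT3AC.dataOfV4chi p (canonPolymerRows q)) 𝔠.b₀ 𝔠.p₀))
    (w := fun n => θBal F.L γ 𝔠.b₀ 𝔠.p₀ n ^ 2) hγ hγ1' 𝔠.b₀_pos (fun n => pow_nonneg (hθ0 n) 2)
    (fun n => pow_le_pow_left₀ (hθ0 (n + 1)) (θBal_succ_le hLn hγ hγ1' hγe 𝔠.b₀_pos.le 𝔠.p₀_pos.le n) 2) ha ha1' hC hCT
    (pintDecompTrivT_canonRows q) (locCount_of_cover_of_volumeC (locCover_canonRows q hκ0.le hκ₀) (locBlockVolumeC_canonRows q))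
    (locMatched_canonRows q) (termSizeTrivT_canonRows q hκ0 le_rfl hw1 hw2) hrow
  exact ⟨p, hp, canonPolymerRows q, 7, _, le_rfl,
    producerConstC_nonneg F (C' := max 1 (K₀ (4 * 2 ^ 3) (2 * 3))) ha1' hC hCT (volWeight_canon_pos 𝔠),
    (printChi_globalSupRateTSlackOn_iff_W _ _ _ _ _ _ _).2 hG⟩

end Summit.QuantumFields.YangMills.Theorems.GlobalSlackCanonicalOnChi


end
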